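import Literature.NumberTheory.LFunctions.VinogradovKorobov
import Literature.NumberTheory.LFunctions.VinogradovKorobovPolynomial
import Literature.NumberTheory.LFunctions.ZetaZeros

/-!
# Inputs of the Mossinghoff–Trudgian–Yang zero-free regions: the printed bounds (3.1)–(3.3), (3.8) and the zero inequalities (Lemmas 4.7, 6.1)

Topic `Literature/NumberTheory/LFunctions`. Third file of the decomposition of the explicit
Vinogradov–Korobov region `Literature.NumberTheory.LFunctions.zero_free_region_vinogradov_korobov` (rh.S10 = Theorem 1.1 of
Mossinghoff–Trudgian–Yang, *Res. Number Theory* 10 (2024) = arXiv:2212.06867, the only arXiv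
version, whose numbering — theorems `n.m`, equations numbered within sections — is used below).
`VinogradovKorobov.lean` proves Theorem 1.1 from Theorem 1.3 (rh.S09), Theorem 1.4 and the
large-height bound of §5; `VinogradovKorobovPolynomial.lean` proves that the degree-40 polynomial
`P₄₀` of Table 2 is admissible. The two remaining analytic statements of the source — Theorem 1.4
(§6) and the bound `M ≥ M₁` of §5 — are each derived there from ONE "zero inequality" relating the
real and imaginary parts of a hypothetical zero (Lemma 6.1, resp. Lemma 4.7, both descending from
Ford's zero-detector method, *Number Theory for the Millennium II* (2002), Lemma 7.1) together with
four printed explicit inputs (§3 of the source):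

* (3.1) a Richert-type bound `|ζ(σ + it)| ≤ A|t|^{B(1−σ)^{3/2}} (log|t|)^{2/3}` (`|t| ≥ 3`,
  `1/2 ≤ σ ≤ 1`) — `Literature.RH.RichertBound A B` (a definition; Ford's `A = 76.2`, `B = 4.45` is the
  named fact `Literature.NumberTheory.LFunctions.zeta_bound_ford` of `VinogradovKorobov.lean`, bridged by
  `Literature.NumberTheory.LFunctions.richertBound_ford`, proved);
* (3.2) Ramaré's bound `ζ(σ) ≤ e^{γ(σ−1)}/(σ−1)` (`σ > 1`), recorded in Bastien–Rogalski 2002 —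
  named fact `Literature.NumberTheory.LFunctions.zeta_real_le_ramare`;
* (3.3) Patel's sub-Weyl bound `|ζ(1/2 + it)| ≤ 307.098|t|^{27/164}` (`|t| ≥ 3`) — named fact
  `Literature.NumberTheory.LFunctions.zeta_half_line_patel`;
* (3.8) the Hasanalizade–Shen–Wong zero-counting bound
  `|N(T) − (T/2π) log(T/2πe)| ≤ 0.1038 log T + 0.2573 log log T + 9.3675` (`T ≥ e`) — named fact
  `Literature.NumberTheory.LFunctions.zetaZeroCount_hasanalizade_shen_wong` (with the tree's `Literature.NumberTheory.LFunctions.zetaZeroCount`).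

This file vendors these, the closed-form constants of Ford's smoothing kernel that enter Lemma 4.7
— `w(0)` (4.3), `W'(0)` (4.6), `c₀,…,c₃` and `H(R)` (4.5), `C₅(R)` (4.7), as functions of the
angle `θ = θ(b₀, b₁)` of (4.1) (`Literature.NumberTheory.LFunctions.IsFordTheta`) — and the two zero inequalities as NAMED
FACTS (`def … : Prop`, D-0014):

* `Literature.NumberTheory.LFunctions.zero_inequality_mossinghoff_trudgian_yang` — Lemma 4.7, for the polynomial `P₄₀`;
* `Literature.NumberTheory.LFunctions.zero_inequality_intermediate_mossinghoff_trudgian_yang` — Lemma 6.1 (for `P₄₀`, as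
  printed, with its numerical constants).

What then remains for rh.S10 (see `NOTES` of the decomposition): (i) §5 of the source — derive
`zero_bound_large_height_mossinghoff_trudgian_yang` from Lemma 4.7, (3.1) with Ford's constants,
(3.2), Theorem 1.4 and the admissibility of `P₄₀` (an explicit-inequality computation with the
source's `E = 1.8821259`, `R = 416`, `T₀ = exp 52238`); (ii) §6 — derive Theorem 1.4 from Lemma 6.1;
(iii) the leaves: Lemma 4.7 and Lemma 6.1 themselves (Ford's Lemmas 2.2–5.1 as adapted in Lemmas
4.1–4.6 of the source, using (3.2), (3.3), (3.8)), Ford's bound (3.1) (explicit Vinogradov mean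
value theorem), Patel's (3.3), Hasanalizade–Shen–Wong's (3.8), Ramaré's (3.2), and Theorem 1.3.

## Faithfulness notes

1. **Sign of `W'(0)` in Lemma 4.7.** Formula (4.6) of the source is the derivative at `0` of the
   Laplace transform `W` of the (non-negative, compactly supported) kernel `w = g ∗ g`, hence is
   negative: numerically `W'(0) = −0.661719…` for `P₄₀` (`θ = 1.13331020636698…`, (4.2)) and
   `−0.747498…` for Ford's `P₄` (`θ = 1.15221…`). The display of Lemma 4.7 writes the left side as
   `λ⁻¹(cos²θ − (W'(0)b₁/(w(0)b₀))((1−β)/λ − 1))`; with the sign of (4.6) this would be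
   *larger* than `λ⁻¹cos²θ`, whereas the source's own substitution (5.5),
   `λ⁻¹[0.17949 − 0.20466((1−β)/λ − 1)]` (`0.17949 ≤ cos²θ = 0.1794909…`,
   `0.20466 ≥ |W'(0)|b₁/(w(0)b₀) = 0.2046593…`), and Ford's (7.9)–(7.10)
   (`W(0) − W(x) ≤ 0.7475x`, `0.7475 ≥ |W'(0)|`, by convexity of `W`) show that the intended and
   proved inequality has `|W'(0)|`: `λ⁻¹(cos²θ − (|W'(0)|b₁/(w(0)b₀))((1−β)/λ − 1))`. We state this
   reading (which is also the weaker one, as `(1−β)/λ − 1 ≥ 0`).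
2. **Scope of Lemma 4.7.** §4 of the source fixes "`b₀`, `b₁` and `b` as in (3.6) or (3.7)", i.e.
   the polynomials `P₄₀`/`P₄₆` (the constant `209.1` absorbs `1.8 b₀/b`), and assumes (3.1) "for some
   `A, B > 0`"; its proof "follows the argument of Ford, Lemma 7.1", whose hypotheses include
   `A > 6.5`. We vendor Lemma 4.7 for `P₄₀` only, for every `(A, B)` satisfying (3.1) with `B > 0`
   and, additionally, Ford's `A > 6.5` — a statement implied by the printed one and sufficient for
   §5, where `(A, B) = (76.2, 4.45)`.
3. **The angle `θ`.** The source defines `θ(b₀, b₁)` as "the unique solution" of (4.1) in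
   `(0, π/2)`; we state Lemma 4.7 for every solution `θ` of (4.1) in `(0, π/2)` (predicate
   `IsFordTheta`), which under the asserted uniqueness is the printed statement, and spares users a
   choice-based definition (to apply the lemma one exhibits a solution near `1.1333102…` by the
   intermediate value theorem).
4. `b`, `b₁` are the exact coefficients of `P₄₀` (`VinogradovKorobovPolynomial.lean`), within
   `10⁻¹⁵` of the printed `3.56453965437134`, `1.74600190914994`; both lemmas are monotone in the
   direction that makes the exact-coefficient statements consequences of the printed ones up to
   that rounding, which the source's final roundings (e.g. `0.20466`, `1.5`, `0.04897601 > M₁`)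
   absorb.

## References

* M. J. Mossinghoff, T. S. Trudgian, A. Yang, *Explicit zero-free regions for the Riemann
  zeta-function*, Res. Number Theory 10 (2024), no. 11 = arXiv:2212.06867: (3.1)–(3.3), (3.6),
  (3.8); §4: (4.1)–(4.7), Lemmas 4.1–4.7; §5: (5.5); §6: (6.1), Lemma 6.1
  (`MossinghoffTrudgianYangRNT2024`).
* K. Ford, *Zero-free regions for the Riemann zeta function*, Number Theory for the Millennium II
  (Urbana 2000), A K Peters 2002, 25–56 = arXiv:1910.08205: Lemma 7.1, (7.9)–(7.10)
  (`Ford2002Millennium`).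
* K. Ford, *Vinogradov's integral and bounds for the Riemann zeta function*, Proc. LMS 85 (2002),
  Thm. 1 (`Ford2002`).
* G. Bastien, M. Rogalski, *Convexité, complète monotonie et inégalités sur les fonctions zêta et
  gamma…*, Canad. J. Math. 54 (2002), 916–944 (`BastienRogalski2002`) — Ramaré's bound (3.2).
* D. Patel, *Explicit sub-Weyl bound for the Riemann zeta function*, PhD thesis, Ohio State 2021
  (`Patel2021`) — (3.3).
* E. Hasanalizade, Q. Shen, P.-J. Wong, *Counting zeros of the Riemann zeta function*, J. Number
  Theory 235 (2022), 219–241, Cor. 1.2 (`HasanalizadeShenWong2022`) — (3.8).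
-/

noncomputable section

open Complex Real Finset

namespace Literature.NumberTheory.LFunctions

/-! ## (3.1): Richert-type bounds near the 1-line -/

/-- A **Richert-type bound** with constants `(A, B)` (Mossinghoff–Trudgian–Yang (3.1); Richert
1967): `|ζ(σ + it)| ≤ A |t|^{B(1−σ)^{3/2}} (log|t|)^{2/3}` for `|t| ≥ 3` and `1/2 ≤ σ ≤ 1`. Ford
(2002, Thm. 1) gives `(A, B) = (76.2, 4.45)` (`zeta_bound_ford`, `richertBound_ford`).
[cite: MossinghoffTrudgianYangRNT2024, (3.1)] -/
def RichertBound (A B : ℝ) : Prop :=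
  ∀ σ t : ℝ, 3 ≤ |t| → 1 / 2 ≤ σ → σ ≤ 1 →
    ‖riemannZeta (σ + t * I)‖ ≤ A * |t| ^ (B * (1 - σ) ^ (3 / 2 : ℝ)) * Real.log |t| ^ (2 / 3 : ℝ)

/-- `|ζ(σ − it)| = |ζ(σ + it)|` (from `ζ(s̄) = conj ζ(s)`), the symmetry by which "it suffices to
consider only `t > 0`" (op. cit. §4). [folklore] -/
theorem norm_riemannZeta_ofReal_add_neg_mul_I (σ t : ℝ) :
    ‖riemannZeta (σ + (((-t : ℝ) : ℂ)) * I)‖ = ‖riemannZeta (σ + t * I)‖ := by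
  have hconj : (σ : ℂ) + ((-t : ℝ) : ℂ) * I = starRingEnd ℂ ((σ : ℂ) + (t : ℂ) * I) := by
    apply Complex.ext <;> simp
  rw [hconj, riemannZeta_conj, Complex.norm_conj]

/-- A Richert-type bound stated for `t ≥ 3` (as in Ford 2002, Thm. 1) gives the two-sided version
(3.1), by conjugation symmetry. [folklore] -/
theorem RichertBound.of_pos {A B : ℝ}
    (h : ∀ σ t : ℝ, 3 ≤ t → 1 / 2 ≤ σ → σ ≤ 1 →
      ‖riemannZeta (σ + t * I)‖ ≤ A * t ^ (B * (1 - σ) ^ (3 / 2 : ℝ)) * Real.log t ^ (2 / 3 : ℝ)) :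
    RichertBound A B := by
  intro σ t ht h1 h2
  rcases le_or_gt 0 t with h0 | h0
  · rw [abs_of_nonneg h0] at ht ⊢
    exact h σ t ht h1 h2
  · have ht' : 3 ≤ -t := by rwa [abs_of_neg h0] at ht
    have key := h σ (-t) ht' h1 h2
    rw [norm_riemannZeta_ofReal_add_neg_mul_I] at key
    rwa [abs_of_neg h0]

/-- Ford's bound (`zeta_bound_ford`, Ford 2002 Thm. 1) is the Richert-type bound (3.1) with
`A = 76.2`, `B = 4.45`, the input of §5 of the source. [cite: Ford2002, Theorem 1] -/
theorem richertBound_ford (h : zeta_bound_ford) : RichertBound 76.2 4.45 :=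
  RichertBound.of_pos h

/-! ## (3.2), (3.3), (3.8): three printed explicit inputs (named facts) -/

/-- NAMED FACT (Ramaré's bound: Bastien–Rogalski 2002, Lemme 1, eq. (6), "si `s > 1`,
`(s − 1)ζ(s) < e^{γ(s−1)}`", `γ` Euler's constant; quoted, with `≤`, as (3.2) of
Mossinghoff–Trudgian–Yang). For real `σ > 1`, `ζ(σ) ≤ e^{γ(σ−1)}/(σ − 1)` (`ζ(σ)` is real; we
state the bound for its real part, in the non-strict form (3.2) used by the source). Used in
Lemmas 4.5–4.7 and §5 of the source in the form `log ζ(1 + η) ≤ γη − log η`. Users take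
`(h : zeta_real_le_ramare)`.
[cite: BastienRogalski2002, Lemme 1, eq. (6)]
[cite: MossinghoffTrudgianYangRNT2024, (3.2)] -/
def zeta_real_le_ramare : Prop :=
  ∀ σ : ℝ, 1 < σ →
    (riemannZeta σ).re ≤ Real.exp (Real.eulerMascheroniConstant * (σ - 1)) / (σ - 1)

/-- NAMED FACT (Patel 2021, explicit sub-Weyl bound, quoted as (3.3) of Mossinghoff–Trudgian–Yang).
For `|t| ≥ 3`, `|ζ(1/2 + it)| ≤ 307.098 |t|^{27/164}`. The input of Theorem 1.4 (§6) of the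
source. Users take `(h : zeta_half_line_patel)`.
[cite: Patel2021, main theorem]
[cite: MossinghoffTrudgianYangRNT2024, (3.3)] -/
def zeta_half_line_patel : Prop :=
  ∀ t : ℝ, 3 ≤ |t| → ‖riemannZeta (1 / 2 + t * I)‖ ≤ 307.098 * |t| ^ (27 / 164 : ℝ)

/-- NAMED FACT (Hasanalizade–Shen–Wong 2022, Corollary 1.2, quoted as (3.8) of
Mossinghoff–Trudgian–Yang). For every `T ≥ e`,
`|N(T) − (T/2π) log(T/(2πe))| ≤ 0.1038 log T + 0.2573 log log T + 9.3675`, where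
`N(T) = Literature.zetaZeroCount T` counts the zeros `β + iγ` of `ζ` with `0 < β < 1`, `0 < γ ≤ T` with
multiplicity (the source's `N(T)`). Users take `(h : zetaZeroCount_hasanalizade_shen_wong)`.
[cite: HasanalizadeShenWong2022, Corollary 1.2]
[cite: MossinghoffTrudgianYangRNT2024, (3.8)] -/
def zetaZeroCount_hasanalizade_shen_wong : Prop :=
  ∀ T : ℝ, Real.exp 1 ≤ T →
    |(zetaZeroCount T : ℝ) - T / (2 * π) * Real.log (T / (2 * π * Real.exp 1))|
      ≤ 0.1038 * Real.log T + 0.2573 * Real.log (Real.log T) + 9.3675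

/-! ## §4: the constants of Ford's smoothing kernel -/

/-- The angle `θ = θ(b₀, b₁)` of the kernel construction (Mossinghoff–Trudgian–Yang (4.1); Ford
2000 (6.x)): a solution in `(0, π/2)` of `sin²θ = (b₁/b₀)(1 − θ cot θ)`. The source asserts the
solution is unique; for `P₄₀` it is `θ = 1.13331020636698…` (4.2).
[cite: MossinghoffTrudgianYangRNT2024, (4.1)] -/
def IsFordTheta (b₀ b₁ θ : ℝ) : Prop :=
  0 < θ ∧ θ < π / 2 ∧ Real.sin θ ^ 2 = b₁ / b₀ * (1 - θ * Real.cot θ)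

/-- `w(0) = (θ tan θ + 3θ cot θ − 3) sec²θ`, the value at `0` of the kernel `w = g ∗ g`,
`g(u) = (cos(u tan θ) − cos θ) sec²θ` on `|u| ≤ θ cot θ` (MTY (4.3)).
[cite: MossinghoffTrudgianYangRNT2024, (4.3)] -/
def fordSmoothW0 (θ : ℝ) : ℝ :=
  (θ * Real.tan θ + 3 * θ * Real.cot θ - 3) / Real.cos θ ^ 2

/-- `W'(0) = [csc θ (3(4θ² − 5) + θ(15 − 4θ²) cot θ) − 3θ sec θ] / (3 sin θ)`, the derivative at
`0` of the Laplace transform `W` of `w` (MTY (4.6)); it is negative (see the module docstring,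
note 1). [cite: MossinghoffTrudgianYangRNT2024, (4.6)] -/
def fordLaplaceWDeriv0 (θ : ℝ) : ℝ :=
  ((Real.sin θ)⁻¹ * (3 * (4 * θ ^ 2 - 5) + θ * (15 - 4 * θ ^ 2) * Real.cot θ)
    - 3 * θ / Real.cos θ) / (3 * Real.sin θ)

/-- `c₀ = 1/(sin θ cos³θ)` (MTY (4.5)). [cite: MossinghoffTrudgianYangRNT2024, (4.5)] -/
def fordC₀ (θ : ℝ) : ℝ := 1 / (Real.sin θ * Real.cos θ ^ 3)

/-- `c₁ = (θ − sin θ cos θ) tan⁴θ` (MTY (4.5)). [cite: MossinghoffTrudgianYangRNT2024, (4.5)] -/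
def fordC₁ (θ : ℝ) : ℝ := (θ - Real.sin θ * Real.cos θ) * Real.tan θ ^ 4

/-- `c₂ = tan³θ sin²θ` (MTY (4.5)). [cite: MossinghoffTrudgianYangRNT2024, (4.5)] -/
def fordC₂ (θ : ℝ) : ℝ := Real.tan θ ^ 3 * Real.sin θ ^ 2

/-- `c₃ = (θ − sin θ cos θ) tan²θ` (MTY (4.5)). [cite: MossinghoffTrudgianYangRNT2024, (4.5)] -/
def fordC₃ (θ : ℝ) : ℝ := (θ - Real.sin θ * Real.cos θ) * Real.tan θ ^ 2

/-- `H(R) = c₀ (1 − tan²θ/R²)⁻² { c₂ ((R+1)²/R³)(e^{2θ cot θ} + 1) + c₁/R² + c₃ }`, the constant in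
`|W₀(z)| ≤ H(R)/|z|³` (`Re z ≥ −1`, `|z| ≥ R ≥ 3`) (MTY, display after (4.6)).
[cite: MossinghoffTrudgianYangRNT2024, §4 (definition of H(R), after (4.6))] -/
def fordH (θ R : ℝ) : ℝ :=
  fordC₀ θ / (1 - Real.tan θ ^ 2 / R ^ 2) ^ 2 *
    (fordC₂ θ * ((R + 1) ^ 2 / R ^ 3) * (Real.exp (2 * θ * Real.cot θ) + 1)
      + fordC₁ θ / R ^ 2 + fordC₃ θ)

/-- `C₅(R) = H(R)(R+1)²/(R³ w(0)) + 1 + 1/R`, the constant in `|F₀(z)| ≤ C₅(R) λ f(0)/|z|²`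
(MTY (4.7); Ford's `c₄`). [cite: MossinghoffTrudgianYangRNT2024, (4.7)] -/
def fordC5 (θ R : ℝ) : ℝ :=
  fordH θ R * (R + 1) ^ 2 / (R ^ 3 * fordSmoothW0 θ) + 1 + 1 / R

/-- "No zeros in the rectangle `1 − λ < Re s ≤ 1`, `t − 1 ≤ Im s ≤ T`" (in Lemmas 4.7, 6.1 of the
source `T = Kt + 1`). [cite: MossinghoffTrudgianYangRNT2024, Lemma 4.7] -/
def ZetaZeroFreeRect (lam t T : ℝ) : Prop :=
  ∀ s : ℂ, 1 - lam < s.re → s.re ≤ 1 → t - 1 ≤ s.im → s.im ≤ T → riemannZeta s ≠ 0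

/-- `b = Σ_{k=1}^{40} b_k` for `P₄₀` (exact; `3.56453965437134` to within `10⁻¹⁵`,
`mtyB40_sum_near`). [cite: MossinghoffTrudgianYangRNT2024, (3.6)] -/
def mtyB40Sum : ℝ :=
  ∑ k ∈ Finset.range 40, mtyB40 (k + 1)

/-! ## Lemma 4.7: the zero inequality behind Theorem 1.1 (named fact) -/

/-- NAMED FACT (Mossinghoff–Trudgian–Yang 2024, **Lemma 4.7**, for the polynomial `P₄₀` of (3.6);
descends from Ford 2000, Lemma 7.1). Assume the Richert-type bound (3.1) with constants `A > 6.5`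
(Ford's hypothesis, see note 2 of the module docstring), `B > 0`. Let `θ ∈ (0, π/2)` solve (4.1)
for `(b₀, b₁) = (1, b₁(P₄₀))`, let `0 < η ≤ 1/4` and `R ≥ 3`. Suppose `β + it` is a zero of `ζ`
with `t ≥ 10000` and `1 − β ≤ η/2`, and that there are no zeros in `1 − λ < Re s ≤ 1`,
`t − 1 ≤ Im s ≤ 40t + 1`, where `0 < λ ≤ min(1 − β, η/(R + 1))`. Then, with `L₁ = log(40t + 1)`,
`L₂ = log log(40t + 1)`, `b₀ = 1`, `b₁`, `b = Σ_{k=1}^{40} b_k` the coefficients of `P₄₀`, and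
`w(0)`, `W'(0)`, `C₅(R)` as in (4.3), (4.6), (4.7):
`λ⁻¹ (cos²θ − (|W'(0)| b₁/(w(0) b₀)) ((1−β)/λ − 1))`
`≤ 0.087π² (b₁/b₀)(1−β)/η²`
`+ (2η)⁻¹ { (b/b₀)((2/3)L₂ + Bη^{3/2}L₁ + log A) + log ζ(1+η) }`
`+ C₅(R)(b/b₀) λ { L₁/3 + [5.409 + 5.392B(η^{−1/2} − 2)]L₁ + 209.1 + η⁻²[(log(A/η) + (2/3)L₂)/1.879 + 0.213] }`
(`|W'(0)|` where the source prints `W'(0)`: note 1 of the module docstring). Users take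
`(h : zero_inequality_mossinghoff_trudgian_yang)`.
[cite: MossinghoffTrudgianYangRNT2024, Lemma 4.7 (with (4.1), (4.3), (4.6), (4.7), (5.5))]
[cite: Ford2002Millennium, Lemma 7.1] -/
def zero_inequality_mossinghoff_trudgian_yang : Prop :=
  ∀ A B : ℝ, 6.5 < A → 0 < B → RichertBound A B →
  ∀ θ : ℝ, IsFordTheta (mtyB40 0) (mtyB40 1) θ →
  ∀ η R : ℝ, 0 < η → η ≤ 1 / 4 → 3 ≤ R →
  ∀ β t : ℝ, 10000 ≤ t → riemannZeta (β + t * I) = 0 → 1 - β ≤ η / 2 →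
  ∀ lam : ℝ, 0 < lam → lam ≤ 1 - β → lam ≤ η / (R + 1) →
    ZetaZeroFreeRect lam t (40 * t + 1) →
    1 / lam * (Real.cos θ ^ 2
        - |fordLaplaceWDeriv0 θ| * mtyB40 1 / (fordSmoothW0 θ * mtyB40 0) * ((1 - β) / lam - 1))
      ≤ 0.087 * π ^ 2 * (mtyB40 1 / mtyB40 0) * (1 - β) / η ^ 2
        + 1 / (2 * η) * (mtyB40Sum / mtyB40 0 * (2 / 3 * Real.log (Real.log (40 * t + 1))
              + B * η ^ (3 / 2 : ℝ) * Real.log (40 * t + 1) + Real.log A)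
            + Real.log (riemannZeta (1 + (η : ℂ))).re)
        + fordC5 θ R * (mtyB40Sum / mtyB40 0) * lam
            * (Real.log (40 * t + 1) / 3
              + (5.409 + 5.392 * B * (1 / Real.sqrt η - 2)) * Real.log (40 * t + 1) + 209.1
              + 1 / η ^ 2 * ((Real.log (A / η) + 2 / 3 * Real.log (Real.log (40 * t + 1))) / 1.879
                  + 0.213))

/-! ## Lemma 6.1: the zero inequality behind Theorem 1.4 (named fact) -/

/-- `J(t) = (27/164) log t + log 307.098`, the logarithm of Patel's sub-Weyl bound (3.3)
(MTY (6.1)). [cite: MossinghoffTrudgianYangRNT2024, (6.1)] -/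
def mtyJ (t : ℝ) : ℝ :=
  27 / 164 * Real.log t + Real.log 307.098

/-- NAMED FACT (Mossinghoff–Trudgian–Yang 2024, **Lemma 6.1**; descends from Ford 2000,
Lemma 9.2, with Patel's bound (3.3)). Suppose `ζ(β + it) = 0` with `t ≥ exp 1000` and
`β ≥ 1 − 1/1712`, and suppose there is `λ ∈ (0, 1 − β]` such that there are no zeros in
`1 − λ < Re s ≤ 1`, `t − 1 ≤ Im s ≤ 40t + 1` (`K = 40`, `b₀ = 1`, `b` those of `P₄₀`, (3.6)). Then
`λ⁻¹ (0.17949 − 0.20466((1−β)/λ − 1)) ≤ 5.746(1−β) + (b/b₀) J(40t + 1) + 0.851`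
`+ 1.0146 λ (b/b₀)(3.5691 L₁ + 5.316 L₂ + 18.439)`, `L₁ = log(40t+1)`, `L₂ = log log(40t+1)`,
`J` as in (6.1). Users take `(h : zero_inequality_intermediate_mossinghoff_trudgian_yang)`.
[cite: MossinghoffTrudgianYangRNT2024, Lemma 6.1] -/
def zero_inequality_intermediate_mossinghoff_trudgian_yang : Prop :=
  ∀ β t : ℝ, Real.exp 1000 ≤ t → riemannZeta (β + t * I) = 0 → 1 - 1 / 1712 ≤ β →
  ∀ lam : ℝ, 0 < lam → lam ≤ 1 - β → ZetaZeroFreeRect lam t (40 * t + 1) →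
    1 / lam * (0.17949 - 0.20466 * ((1 - β) / lam - 1))
      ≤ 5.746 * (1 - β) + mtyB40Sum / mtyB40 0 * mtyJ (40 * t + 1) + 0.851
        + 1.0146 * lam * (mtyB40Sum / mtyB40 0)
            * (3.5691 * Real.log (40 * t + 1) + 5.316 * Real.log (Real.log (40 * t + 1)) + 18.439)

/-! ## Small proved consequences (sanity of the interfaces) -/

/-- In the situation of Lemma 6.1 the real part satisfies `β < 1` (no zeros on `Re s ≥ 1`,
Mathlib's `riemannZeta_ne_zero_of_one_le_re`), so `1 − β > 0`. [folklore] -/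
theorem one_sub_pos_of_riemannZeta_eq_zero {β t : ℝ} (h : riemannZeta (β + t * I) = 0) :
    0 < 1 - β := by
  rw [sub_pos]
  by_contra hβ
  exact riemannZeta_ne_zero_of_one_le_re (s := β + t * I) (by simp [not_lt.1 hβ]) h

/-- A zero-free rectangle shrinks: `ZetaZeroFreeRect` is antitone in `λ` and in the height window.
[folklore] -/
theorem ZetaZeroFreeRect.mono {lam lam' t t' T T' : ℝ} (h : ZetaZeroFreeRect lam t T)
    (hl : lam' ≤ lam) (ht : t ≤ t') (hT : T' ≤ T) : ZetaZeroFreeRect lam' t' T' :=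
  fun s h1 h2 h3 h4 ↦ h s (by linarith) h2 (by linarith) (by linarith)

end Literature.NumberTheory.LFunctions
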